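import Summits.AnomalousDissipation.AnomalousDissipation.Theses.TaylorCertificates
import Literature.Analysis.FluidPDE.StatisticalSolutionDirac

/-!
# Line `dissipate-or-move-transport-dual` on the crux `TaylorCertificates.KolmogorovFloor`
(stmt-AnomalousDissipation-14030, rank 2) — crux-plan seat, generation 2, 2026-08-16

**THIS IS NOT A CONCLUDING SKELETON (verdict: no-skeleton).** No `stub_*` is declared and no theorem of
this file concludes the route decl `KolmogorovFloor` without hypotheses; `ledger skeleton check` must NOT
be run on it. What the file is: the typed, `lean check`ed record behind the verdict —

* §0 the objects of the idea card (`Ideas/dissipate-or-move-transport-dual.md`, typed first in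
  `Cruxes/KolmogorovFloor/SketchIdeator2.lean` §1), with TWO CORRECTIONS found by this seat:
  (c1) `IsBudgeted` band-limits the TEST FIELDS `gᵢ` (as the crux does), not only the gradients `Φ₁'(u)`
       — otherwise the transport defect is taken over a class the crux's certificates need not lie in and
       the transfer `C⁺ → crux` compares incomparable suprema;
  (c2) the slack term of (DoM) is the POSITIVE PART `2Θ·(∫(D − (u,f))dμ)⁺`, which is the exact value of
       `sup_{θ₁ ∈ [−Θ,0]} 2θ₁∫((u,f) − D)dμ`; SketchIdeator2 wrote `2Θ·|∫(D − (u,f))dμ|`, a WEAKER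
       inequality (credit for measures whose mean injection exceeds their mean dissipation, which no
       certificate with `θ₁ ≤ 0` can cash) from which the floor cannot be recovered by duality.
* §1 the WOULD-BE positive skeleton, typed to show the verdict is not a typing failure: two statements
  `TransferStatement` (exact-dual direction `DissipateOrMoveAt → floor data`, plausible: inf-compact
  minimax on the finite-enstrophy Leray ball) and `ContentStatement` (`∃ f, DissipateOrMove f`), and the
  kernel-checked composition `kolmogorovFloor_of_transfer_of_content` (conclusion = the crux BY NAME, the
  two statements as explicit hypotheses — deliberately the `skeleton.extra-hypothesis` shape, so that the
  file cannot be registered as a line by accident).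
* §2 WHY NO SKELETON, typed: a single SLOW QUIET DIRAC kills (DoM) at one viscosity
  (`not_dissipateOrMoveAt_of_slowQuietDirac`, PROVED: evaluate at `Measure.dirac a`), hence a family of
  them kills `DissipateOrMove f` (`not_dissipateOrMove_of_slowQuietDiracs`, PROVED); the DRESSED LAMINAR
  RAY `a_ν = ν^{-3/8}U + ν^{3/8}b_K` (Cruxes/KolmogorovFloor/DRESSED-RAY-r1-3.md Thm A (a1)–(a6) + Thm B;
  TRIAGE-r1-3 gen 2 (Y2): a good shear frame exists for EVERY trigonometric-polynomial force; typed as the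
  negative line `Lines/dressed-laminar-ray.lean :: RayFamily`) is such a family for every polynomial force
  (`DressedRayDiracs`, paper theorem modulo the two measured 1-D tail bounds (R4)/(R5)), so the content
  statement needs a NON-polynomial force (`content_needs_nonpolynomial_force`, PROVED logic) and dies
  outright under THEOREM C (`not_content_of_dressedRayDiracsAll`, PROVED logic) — the conjecture-with-recipe
  nobody on the panel (3 triagers, 2 crux-plan seats) can name a mechanism against.

Disproof.lean (cdisprove cycle 1) honoured: (F5) `false_without_finiteEnstrophy` — every Dirac here sits at a
finite-enstrophy state (`SlowQuietDiracAt` carries `eGradNormSq ≠ ⊤`), nothing uses the junk `D = 0`;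
(F1)/(F2)/(F4) are instances of §2 at `δ_0`, `δ_{steady}`, `δ_{phantom}`; (F8) `weights_vanish` is consistent
with (c2): the slack is `o(1)` at every enemy on record. No statement of this file asserts a floor, so none is
an instance refuted by the landed `Theorems/KolmogorovFloor/Negative/*` lemmas (`not_floor_sixth`,
`not_floor_lt_half`, …).
-/

noncomputable section

set_option linter.dupNamespace false

open MeasureTheory Filter
open scoped ENNReal

namespace Summit.AnomalousDissipation.AnomalousDissipation.Cruxes.KolmogorovFloor.DissipateOrMoveTransportDual

open Literature.Analysis.FunctionSpaces Literature.Analysis.FluidPDE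
open Summit.AnomalousDissipation.AnomalousDissipation.Theses.TaylorCertificates

/-- Local notation: the flat 3-torus. -/
local notation "𝕋³" => UnitAddTorus (Fin 3)
/-- Local notation: velocity values. -/
local notation "E³" => EuclideanSpace ℝ (Fin 3)
/-- Local notation: `L²(T³; ℝ³)`. -/
local notation "L2" => (Lp (EuclideanSpace ℝ (Fin 3)) 2 (volume : Measure (UnitAddTorus (Fin 3))))
/-- Local notation: the energy space `H`. -/
local notation "H3" => (Torus.energySpace (Fin 3))

/-! ## §0 Objects of the card (SketchIdeator2 §1, with corrections (c1), (c2)) -/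

/-- Pointwise strain bound of a smooth field: `sup_{x, |η| = 1} |⟪η, (η·∇)W(x)⟫|` — the quantity the packet
lemma prices (`Torus.convect (fun _ => η) W x = (η·∇)W(x)`). Junk `sSup` conventions apply. -/
def strainSup (W : 𝕋³ → E³) : ℝ :=
  sSup {r : ℝ | ∃ (x : 𝕋³) (η : E³), ‖η‖ = 1 ∧ r = |inner ℝ η (Torus.convect (fun _ => η) W x)|}

/-- (c1) A cylindrical functional is `(N, S)`-BUDGETED if its TEST FIELDS are band-limited at `N` (the
crux's admissibility, verbatim) and every multiplier field `Φ₁'(u)` has strain at most `S` (the packet-lemma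
pricing `S ≍ (1+2Θ)νN²`, necessary at every bounded state up to the factor 8 of TRIAGE-r1-3 gen 2 (Y3)). -/
def IsBudgeted (Φ : Torus.CylindricalTest (Fin 3)) (N : ℕ) (S : ℝ) : Prop :=
  (∀ i, Torus.fourierTruncate N (Φ.g i) = Φ.g i) ∧ ∀ u : H3, strainSup (Φ.grad u) ≤ S

/-- The viscous dissipation observable `D(u) = ν‖∇u‖²` (junk `0` at infinite enstrophy, as in the crux). -/
def dissipation (ν : ℝ) (u : H3) : ℝ :=
  ν * (Torus.eGradNormSq ((u : L2) : 𝕋³ → E³)).toReal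

/-- The TRANSPORT DEFECT of a measure `μ` on `H` under `NS_ν(f)` at resolution `N`: the Kantorovich–Rubinstein
norm of the Liouville functional `Ψ ↦ ∫⟨F_ν(u), Ψ'(u)⟩ dμ` over unit-budget cylindrical functionals — the
`W₁`-speed of `μ` in the cheapest-stress ground metric; zero on (relaxed) stationary statistics. -/
def transportDefect (N : ℕ) (ν : ℝ) (f : 𝕋³ → E³) (μ : Measure H3) : ℝ :=
  sSup {r : ℝ | ∃ Ψ : Torus.CylindricalTest (Fin 3), IsBudgeted Ψ N 1 ∧
    r = ∫ (u : H3), Torus.nsGeneratorPairing ν f u (Ψ.grad u) ∂μ}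

/-- (c2) **DISSIPATE-OR-MOVE** at `(ν, N, S, Θ, ε₀)` for the force `f` — the EXACT Lagrange dual value of a
budgeted floor: every Borel probability measure carried by the finite-enstrophy part of the Leray ball, with
integrable dissipation and work, satisfies `ε₀ ≤ ∫D dμ + S·transportDefect(μ) + 2Θ·(∫D dμ − ∫(u,f) dμ)⁺`. -/
def DissipateOrMoveAt (ν : ℝ) (N : ℕ) (S Θ ε₀ : ℝ) (f : 𝕋³ → E³) : Prop :=
  ∀ μ : Measure H3, IsProbabilityMeasure μ →
    (∀ᵐ (u : H3) ∂μ, Torus.eGradNormSq ((u : L2) : 𝕋³ → E³) ≠ ⊤ ∧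
        ‖u‖ ^ 2 ≤ 16 * (∫ x, ‖f x‖ ^ 2) / ν ^ 2) →
    Integrable (fun u : H3 => dissipation ν u) μ →
    Integrable (fun u : H3 => Torus.pairing (u : L2) f) μ →
      ε₀ ≤ (∫ (u : H3), dissipation ν u ∂μ) + S * transportDefect N ν f μ
            + 2 * Θ * max ((∫ (u : H3), dissipation ν u ∂μ) - ∫ (u : H3), Torus.pairing (u : L2) f ∂μ) 0

/-- The card's TRANSFER TARGET `C⁺` (uniform form): dissipate-or-move along `ν → 0` at Kolmogorov resolution
`1 ≤ N ≤ Cν^{-3/4}` with budget `S_ν = c(1+2Θ)νN²` — the exchange rate `νN² ≍ 1/τ_η`. -/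
def DissipateOrMove (f : 𝕋³ → E³) : Prop :=
  ∃ (ε₀ C Θ c ν₀ : ℝ), 0 < ε₀ ∧ 0 < ν₀ ∧ 0 ≤ Θ ∧ 0 < c ∧ ∀ ν : ℝ, 0 < ν → ν < ν₀ →
    ∃ N : ℕ, 1 ≤ N ∧ (N : ℝ) ≤ C * ν ^ (-(3 / 4 : ℝ)) ∧
      DissipateOrMoveAt ν N (c * (1 + 2 * Θ) * ν * (N : ℝ) ^ 2) Θ ε₀ f

/-! ## §1 The would-be positive skeleton (typed; NOT registered — see §2) -/

/-- Floor data at ONE viscosity in the crux's literal shape, at a GIVEN resolution `N`, weight bound `Θ`, floor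
`ε` (the inner block of `KolmogorovFloor` after `∃ N`, without the resolution inequality). -/
def FloorDataWith (ν : ℝ) (N : ℕ) (Θ ε : ℝ) (f : 𝕋³ → E³) : Prop :=
  ∃ (Φ₁ : Torus.CylindricalTest (Fin 3)) (θ₁ : ℝ),
    (∀ i, Torus.fourierTruncate N (Φ₁.g i) = Φ₁.g i) ∧ -Θ ≤ θ₁ ∧ θ₁ ≤ 0 ∧
    ∀ u : Literature.Analysis.FunctionSpaces.Torus.energySpace (Fin 3), let uf : UnitAddTorus (Fin 3) → EuclideanSpace ℝ (Fin 3) := ((u : MeasureTheory.Lp (EuclideanSpace ℝ (Fin 3)) 2 (MeasureTheory.volume : MeasureTheory.Measure (UnitAddTorus (Fin 3)))) : UnitAddTorus (Fin 3) → EuclideanSpace ℝ (Fin 3)); let D : ℝ := ν * (Literature.Analysis.FunctionSpaces.Torus.eGradNormSq uf).toReal; let P : ℝ := Literature.Analysis.FluidPDE.Torus.pairing (u : MeasureTheory.Lp (EuclideanSpace ℝ (Fin 3)) 2 (MeasureTheory.volume : MeasureTheory.Measure (UnitAddTorus (Fin 3)))) f - D; Literature.Analysis.FunctionSpaces.Torus.eGradNormSq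 uf ≠ ⊤ → ‖u‖ ^ 2 ≤ 16 * (∫ x, ‖f x‖ ^ 2) / ν ^ 2 → ε ≤ D + Literature.Analysis.FluidPDE.Torus.nsGeneratorPairing ν f u (Φ₁.grad u) + 2 * θ₁ * P

/-- WOULD-BE STUB 1 (`stub_transfer`, plausible, size M+M+S on paper) — the exact-dual direction at one
viscosity: (DoM) at `(ν, N, S, Θ, ε₀)` gives a band-limited certificate with weight in `[−Θ, 0]` and floor
`ε₀/2`. Paper route: inf-compact minimax — on `P({D ≤ M} ∩ ball)` (compact, metrisable: bounded enstrophy +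
bounded energy is `L²`-compact by Rellich) the Lagrangian `∫[(1+2|θ|)D + ⟨F_ν,Ψ'⟩ − 2|θ|(u,f)]dμ` is weak-*
lsc in `μ` (D lsc, the generator terms continuous on bounded-enstrophy sets) and affine in `(Ψ, θ)` over the
convex cone of budgeted cylindrical tests (Sion); states with `D > M ≍ ε₀ + S·sup_ball‖F_ν‖^*_N + 2Θ‖u‖‖f‖`
satisfy the floor under ANY budgeted multiplier because `‖F_ν(u)‖^*_N` is bounded on the ball
(`I(u,W) ≤ strain(W)‖u‖²`). No Galerkin reduction is needed in this formulation (the `μ`-side is already all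
of the ball); the octave cross-term of card (4) is absorbed by (c1). -/
def TransferStatement : Prop :=
  ∀ f : 𝕋³ → E³, Torus.IsSmooth f → Torus.IsDivFree f → Torus.HasZeroMean f →
    ∀ (ν : ℝ) (N : ℕ) (S Θ ε₀ : ℝ), 0 < ν → 0 < S → 0 ≤ Θ → 0 < ε₀ →
      DissipateOrMoveAt ν N S Θ ε₀ f → FloorDataWith ν N Θ (ε₀ / 2) f

/-- WOULD-BE STUB 2 (`stub_content`) — the content of any positive use of the line: ONE admissible force whose
Kolmogorov-resolved statistics dissipate or move. STATUS: refuted on paper for every trigonometric-polynomial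
force (§2) and conjecturally for every smooth force (THEOREM C of DRESSED-RAY-r1-3 §5) — the reason no
skeleton is filed. -/
def ContentStatement : Prop :=
  ∃ f : 𝕋³ → E³, Torus.IsSmooth f ∧ Torus.IsDivFree f ∧ Torus.HasZeroMean f ∧ DissipateOrMove f

/-- The would-be composition `KolmogorovFloor_of` (kernel-checked logic; conclusion = the crux BY NAME; the two
statements enter as EXPLICIT hypotheses so that this is not a registrable skeleton): transfer + content give a
Kolmogorov-class floor with floor `ε₀/2`, the same `C, Θ, ν₀`. -/
theorem kolmogorovFloor_of_transfer_of_content (hT : TransferStatement) (hC : ContentStatement) :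
    KolmogorovFloor := by
  obtain ⟨f, hfs, hfd, hfz, ε₀, C, Θ, c, ν₀, hε₀, hν₀, hΘ, hc, hall⟩ := hC
  refine ⟨f, hfs, hfd, hfz, ε₀ / 2, C, Θ, ν₀, half_pos hε₀, hν₀, fun ν hν hνν₀ => ?_⟩
  obtain ⟨N, hN1, hNC, hDoM⟩ := hall ν hν hνν₀
  have hN : (0 : ℝ) < N := by exact_mod_cast hN1
  have h12 : (0 : ℝ) < 1 + 2 * Θ := by linarith
  have hS : 0 < c * (1 + 2 * Θ) * ν * (N : ℝ) ^ 2 := by positivity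
  obtain ⟨Φ₁, θ₁, hband, hθ, hθ', hu⟩ := hT f hfs hfd hfz ν N _ Θ ε₀ hν hS hΘ hε₀ hDoM
  exact ⟨N, Φ₁, θ₁, hNC, hband, hθ, hθ', hu⟩

/-! ## §2 Why no skeleton: slow quiet Diracs kill (DoM) — and the dressed laminar ray is one, for every force the route can name -/

/-- A SLOW QUIET DIRAC for `(ν, N, S, Θ, ε₀, f)`: a finite-enstrophy state `a` of the Leray ball whose
dissipation, budget-dual generator size `B ≥ sup{⟨F_ν(a), Ψ'(a)⟩ : Ψ unit-budget at N}` and injection slack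
add up to less than `ε₀`:  `D(a) + S·B + 2Θ·(D(a) − (a,f))⁺ < ε₀`.  (Type (i) of the card's enemy census; its
negation at all quiet states is the card's `QC(f)`.) -/
def SlowQuietDiracAt (ν : ℝ) (N : ℕ) (S Θ ε₀ : ℝ) (f : 𝕋³ → E³) (a : H3) : Prop :=
  Torus.eGradNormSq ((a : L2) : 𝕋³ → E³) ≠ ⊤ ∧ ‖a‖ ^ 2 ≤ 16 * (∫ x, ‖f x‖ ^ 2) / ν ^ 2 ∧
  ∃ B : ℝ, 0 ≤ B ∧
    (∀ Ψ : Torus.CylindricalTest (Fin 3), IsBudgeted Ψ N 1 →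
      Torus.nsGeneratorPairing ν f a (Ψ.grad a) ≤ B) ∧
    dissipation ν a + S * B + 2 * Θ * max (dissipation ν a - Torus.pairing (a : L2) f) 0 < ε₀

/-- At a Dirac mass the transport defect is at most any bound of the generator against unit-budget
multipliers (the `sSup` junk value `0` for an empty index set is covered by `0 ≤ B`). -/
theorem transportDefect_dirac_le {N : ℕ} {ν : ℝ} {f : 𝕋³ → E³} (a : H3) {B : ℝ} (hB0 : 0 ≤ B)
    (hB : ∀ Ψ : Torus.CylindricalTest (Fin 3), IsBudgeted Ψ N 1 →
      Torus.nsGeneratorPairing ν f a (Ψ.grad a) ≤ B) :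
    transportDefect N ν f (Measure.dirac a) ≤ B := by
  haveI : MeasurableSingletonClass H3 := OpensMeasurableSpace.toMeasurableSingletonClass
  unfold transportDefect
  by_cases hne : {r : ℝ | ∃ Ψ : Torus.CylindricalTest (Fin 3), IsBudgeted Ψ N 1 ∧
      r = ∫ (u : H3), Torus.nsGeneratorPairing ν f u (Ψ.grad u) ∂(Measure.dirac a)}.Nonempty
  · refine csSup_le hne ?_
    rintro r ⟨Ψ, hΨ, rfl⟩
    rw [integral_dirac]
    exact hB Ψ hΨ
  · rw [Set.not_nonempty_iff_eq_empty] at hne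
    rw [hne, Real.sSup_empty]
    exact hB0

/-- **One slow quiet Dirac kills (DoM) at that viscosity** (evaluate at `μ = δ_a`). PROVED. -/
theorem not_dissipateOrMoveAt_of_slowQuietDirac {ν : ℝ} {N : ℕ} {S Θ ε₀ : ℝ} {f : 𝕋³ → E³}
    (hS : 0 ≤ S) (a : H3) (ha : SlowQuietDiracAt ν N S Θ ε₀ f a) :
    ¬ DissipateOrMoveAt ν N S Θ ε₀ f := by
  haveI : MeasurableSingletonClass H3 := OpensMeasurableSpace.toMeasurableSingletonClass
  obtain ⟨hfin, hball, B, hB0, hB, hlt⟩ := ha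
  intro h
  have hae : ∀ᵐ (u : H3) ∂(Measure.dirac a), Torus.eGradNormSq ((u : L2) : 𝕋³ → E³) ≠ ⊤ ∧
      ‖u‖ ^ 2 ≤ 16 * (∫ x, ‖f x‖ ^ 2) / ν ^ 2 := by
    rw [ae_dirac_eq]
    exact Filter.eventually_pure.mpr ⟨hfin, hball⟩
  have h1 := h (Measure.dirac a) inferInstance hae (Torus.integrable_dirac a _) (Torus.integrable_dirac a _)
  rw [integral_dirac, integral_dirac] at h1
  have h2 : S * transportDefect N ν f (Measure.dirac a) ≤ S * B :=
    mul_le_mul_of_nonneg_left (transportDefect_dirac_le a hB0 hB) hS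
  linarith

/-- SLOW QUIET DIRACS for `f` at Kolmogorov resolution, in the quantifier order of the crux: for all constants
there is an arbitrarily small `ν` at which EVERY admissible resolution `1 ≤ N ≤ Cν^{-3/4}` has a slow quiet
Dirac for the budget `S_ν = c(1+2Θ)νN²`. -/
def SlowQuietDiracs (f : 𝕋³ → E³) : Prop :=
  ∀ (ε₀ C Θ c ν₀ : ℝ), 0 < ε₀ → 0 < ν₀ → 0 ≤ Θ → 0 < c →
    ∃ ν : ℝ, 0 < ν ∧ ν < ν₀ ∧ ∀ N : ℕ, 1 ≤ N → (N : ℝ) ≤ C * ν ^ (-(3 / 4 : ℝ)) →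
      ∃ a : H3, SlowQuietDiracAt ν N (c * (1 + 2 * Θ) * ν * (N : ℝ) ^ 2) Θ ε₀ f a

/-- **Slow quiet Diracs kill the transfer target.** PROVED. -/
theorem not_dissipateOrMove_of_slowQuietDiracs {f : 𝕋³ → E³} (h : SlowQuietDiracs f) :
    ¬ DissipateOrMove f := by
  rintro ⟨ε₀, C, Θ, c, ν₀, hε₀, hν₀, hΘ, hc, hall⟩
  obtain ⟨ν, hν, hνν₀, hN⟩ := h ε₀ C Θ c ν₀ hε₀ hν₀ hΘ hc
  obtain ⟨N, hN1, hNC, hDoM⟩ := hall ν hν hνν₀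
  obtain ⟨a, ha⟩ := hN N hN1 hNC
  have h12 : (0 : ℝ) ≤ 1 + 2 * Θ := by linarith
  have hS : 0 ≤ c * (1 + 2 * Θ) * ν * (N : ℝ) ^ 2 := by positivity
  exact not_dissipateOrMoveAt_of_slowQuietDirac hS a ha hDoM

/-- **THE OBSTRUCTION (paper theorem).** Every admissible TRIGONOMETRIC-POLYNOMIAL force has slow quiet Diracs:
the dressed laminar ray `a_ν = ν^{-3/8}U + ν^{3/8}b_K` (`U = sin(2πξ·x)ê` an Euler shear in a good frame — one
exists for every finite Fourier support by TRIAGE-r1-3 gen 2 (Y2); `b_K = P_K L_U⁻¹f` the truncated inviscid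
linear response, THEOREM B; `K = ⌈ν^{-0.7}⌉`) has `‖a_ν‖² ≍ ν^{-3/4}/2` (in the ball), `D(a_ν) ≤ 2G_Uν^{1/4}
+ 4C_bν^{1.05}`, `(a_ν,f) = O(ν^{3/8})`, and generator `⟨F_ν(a_ν),W⟩ ≤ den·M_W` with `den ≤ C₁ν^{5/8}` and
`M_W ≤ √6/(2π)` for every `W` of strain `≤ 1` (Korn: `‖∇W‖₂² = 2‖e(W)‖₂² ≤ 6`), so with `S_ν ≤ c(1+2Θ)C²ν^{-1/2}`:
`D + S_ν·B + 2Θ(D − (a,f))⁺ ≤ O(ν^{1/4}) + 0.39·c(1+2Θ)C²C₁·ν^{1/8} + O(Θν^{1/4}) → 0 < ε₀` — for EVERY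
`C, Θ, c`. Sources: DRESSED-RAY-r1-3.md §2 (a1)–(a6), §3; Lines/dressed-laminar-ray.lean (`RayFamily`,
`stub_rayOfResponse`, `stub_axisFrameResponse`, `stub_skewFrameResponse`); TRIAGE-r1-1 App. B, TRIAGE-r1-2 §N,
TRIAGE-r1-3 (X3)/(Y2) (independent re-derivations + numerics j009650/j009978/j010983). -/
def DressedRayDiracs : Prop :=
  ∀ f : 𝕋³ → E³, Torus.IsSmooth f → Torus.IsDivFree f → Torus.HasZeroMean f →
    (∃ d : ℕ, Torus.fourierTruncate d f = f) → SlowQuietDiracs f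

/-- THEOREM C level (DRESSED-RAY-r1-3 §5, conjecture-with-recipe; = `stub_smoothForceRay` of the negative line):
every admissible smooth force has slow quiet Diracs (ν-dependent frames of size `ν^{-O(σ')}`, losses polynomial
in the frame against the spare power `ν^{1/8}`). -/
def DressedRayDiracsAll : Prop :=
  ∀ f : 𝕋³ → E³, Torus.IsSmooth f → Torus.IsDivFree f → Torus.HasZeroMean f → SlowQuietDiracs f

/-- **Consequence 1 (PROVED logic): any positive use of this line must name a NON-polynomial force.** -/
theorem content_needs_nonpolynomial_force (hR : DressedRayDiracs) (hC : ContentStatement) :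
    ∃ f : 𝕋³ → E³, Torus.IsSmooth f ∧ Torus.IsDivFree f ∧ Torus.HasZeroMean f ∧
      (¬ ∃ d : ℕ, Torus.fourierTruncate d f = f) ∧ DissipateOrMove f := by
  obtain ⟨f, hfs, hfd, hfz, hD⟩ := hC
  exact ⟨f, hfs, hfd, hfz, fun hp => not_dissipateOrMove_of_slowQuietDiracs (hR f hfs hfd hfz hp) hD, hD⟩

/-- **Consequence 2 (PROVED logic): under THEOREM C the content statement is false — the line is dead as a
positive line for every smooth force.** -/
theorem not_content_of_dressedRayDiracsAll (hR : DressedRayDiracsAll) : ¬ ContentStatement := by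
  rintro ⟨f, hfs, hfd, hfz, hD⟩
  exact not_dissipateOrMove_of_slowQuietDiracs (hR f hfs hfd hfz) hD

end Summit.AnomalousDissipation.AnomalousDissipation.Cruxes.KolmogorovFloor.DissipateOrMoveTransportDual
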